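/-
Copyright (c) 2026 the pub-hodgecm-mathlib formalisation cell (harness21).  Prover seat hodgecm-mathlib-K2E3-p04 (g3), Track B ∕ K2-LIT
(build stream 29), h413 = `stmt-HodgeConjecture-24833`, line `K2_E3_EllipticInputs`, unit U4 «Keys» — road I («Keys' own road»), brick I-3j
«THE TRACE-ONE ELEMENT AT AN UNRAMIFIED INERT PLACE, DYADIC INCLUDED».  2026-09-04.
-/
import Literature.NumberTheory.Automorphic.UnitaryGroupInertPlaceHyperbolicBasisDyadic   -- ★ `exists_smul_sub_notMem`: `c` moves some `a ∈ 𝓞_L` modulo `𝔓_w` at an unramified non-split place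
import Literature.NumberTheory.Automorphic.UnitaryGroupBorelInduction                   -- ★ `conjLocal_conjLocal_cm`; brings ★ `conjLocal_algebraMap`, `PlacesOver.subsingleton_of_smul_eq`
import HarnessLib

/-!
# h413 ∕ Track B «K2-LIT», unit U4 «Keys», road I brick I-3j: AN ELEMENT OF TRACE `1` IN `𝒪_w` AT EVERY UNRAMIFIED NON-SPLIT PLACE — DYADIC PLACES INCLUDED
# (`∃ z₀ ∈ 𝒪_{L_w}`, `z₀ + σ z₀ = 1`)   [Serre1979 Ch. V §2 Prop. 3 ∕ Ch. I §7; NeukirchANT1999 Ch. II §6–§7]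

Cell `pub/hodgecm-mathlib`, crux H413 = `stmt-HodgeConjecture-24833` (lane `--supports … --as helper`), route HCCMUnconditional; dealer K2E3-plan (g2) 02:16Z (2)
(«DEFAULT (a) «=» — TRACE-ONE ELEMENT AT UNRAMIFIED (incl. DYADIC) INERT PLACES; also a (J3d)∕(d-i) input»).  THEOREMS ONLY (0 def ∕ 0 instance ∕ 0 notation ∕ 0 sorry);
★-only imports.  This is the one hypothesis left open by ★ p856585 `K2E3HeightBallIndexViaCentre.measure_heightBall_inv_eq_mul_of_traceOne` (the index
`[B_q : B₁] = q_F` of the height balls of `N(L⁺_v)` — hence Macdonald's formula for the spherical `c`-function of `U(Φ₃)(L⁺_v)` — at an INERT place of ANY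
residue characteristic): an element `z₀ ∈ E_v = Π_{w ∣ v} L_w` with `z₀ + σ z₀ = 1` and `|z₀|_w ≤ 1`.  At `v ∤ 2` one takes `z₀ = ½`; at a dyadic place `½` is not
integral, and the element exists iff the trace `𝒪_{L_w} → 𝒪_{L⁺_v}` is onto, i.e. iff `w ∣ v` is UNRAMIFIED.

THE MATHEMATICS (global, three lines).  `v` non-split (`c • w = w`) and unramified in `L`.  By ★ `exists_smul_sub_notMem` (decomposition group `{1, c}` ↠
`Aut(k_w∕k_v) ≠ 1` since `f(w|v) = 2`) there is `a ∈ 𝓞_L` with `t := c a − a ∉ 𝔓_w`.  Put **`b := c(a) ∕ t ∈ L`**.  Then `c t = −t`, so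
`b + c b = c(a)∕t + a∕(−t) = (c a − a)∕t = 1`, and `|b|_w = |c a|_w ∕ |t|_w = |c a|_w ≤ 1` because `t` is a `w`-adic unit and `c a ∈ 𝓞_L`.  The local statements are the
images of `b` in `L_w` (`σ_w = galAdicCompletionMap c`) and in `E_v = Π_{w′ ∣ v} L_{w′}` (`σ = c ⊗ 1 = conjLocal`; one factor at a non-split place).
* §1 **`exists_traceOne_valuation_le_one`** — GLOBAL: `∃ b : L, b + c b = 1 ∧ v_w(b) ≤ 1`.
* §2 **`exists_traceOne_adicCompletion`** — in `L_w`: `∃ b, Valued.v b ≤ 1 ∧ b + σ_w b = 1`; **`exists_traceOne_adicCompletionIntegers`** — the same `b` as an element of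
  `𝒪_w = w.adicCompletionIntegers L`.
* §3 **`exists_traceOne_localRing`** — in `E_v`: `∃ z₀ : LocalRing L v, z₀ + conjLocal z₀ = 1 ∧ ∀ w′, Valued.v (z₀ w′) ≤ 1` — VERBATIM the binders `z₀ hz₀ hz₀1` of ★
  p856585 §4; and `exists_traceOne_localRing_of_two` records that at `v ∤ 2` nothing is needed (`z₀ = ½`, ★ `isUnit_two_localRing`-free: `2⁻¹` in each factor).

HONEST LABEL.  HC_CM is proved only modulo the 7 printed citations (2 remaining named inputs: hLiu418 = `stmt-HodgeConjecture-24832`, h413 = `stmt-HodgeConjecture-24833`) until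
rung 0 closes; count-neutral (road I helper; consumers: Macdonald∕junction at dyadic inert places (this seat, next file), (J3d)∕(d-i) dyadic-unramified masses (K2E4-p14, K2E3-p06)).

## References
* [Serre1979] J.-P. Serre, *Local Fields*, GTM 67 (1979), Ch. I §7 Prop. 20–21 (decomposition∕inertia, `D∕I ≅ Gal(k_w∕k_v)`); Ch. V §2 Prop. 3 (trace onto iff unramified —
  proof via surjectivity of the residual trace); Ch. III §3.
* [NeukirchANT1999] J. Neukirch, *Algebraic Number Theory* (1999), Ch. II §6–§7 (unramified extensions: `tr(𝒪_E) = 𝒪_F`), Ch. I §8–§9.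
* [Rogawski1990] J. D. Rogawski, *Automorphic Representations of Unitary Groups in Three Variables* (1990), §1.10 p. 9 (`E_v`, `σ`), §4.5 p. 45 (Macdonald at inert places).
-/

set_option autoImplicit false
-- the mandated namespace repeats the single-problem summit's segment (`HodgeConjecture.HodgeConjecture`)
set_option linter.dupNamespace false

noncomputable section

open NumberField IsDedekindDomain
open Literature.NumberTheory.Automorphic Literature.NumberTheory.Automorphic.UnitaryGroup

namespace Summit.HodgeConjecture.HodgeConjecture.Cruxes.H413.K2E3TraceOneAtUnramifiedInertPlace

variable (L : Type) [Field L] [NumberField L] [IsCMField L] (v : HeightOneSpectrum (𝓞 ↥(maximalRealSubfield L)))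
  (w : PlacesOver L v) (hw : IsCMField.complexConj L • w.1 = w.1)

/-! ## §1 A global element of trace `1`, integral at `w` -/

include hw in
/-- **A GLOBAL ELEMENT OF TRACE `1`, INTEGRAL AT `w`.**  `v` non-split (`c • w = w`), unramified in `L` (any residue characteristic): there is `b ∈ L` with
`b + c b = 1` and `v_w(b) ≤ 1` — namely `b = c(a)∕(c a − a)` for any `a ∈ 𝓞_L` moved by `c` modulo `𝔓_w` (★ `exists_smul_sub_notMem`): `c a − a` is a `w`-unit
and `c(c a − a) = −(c a − a)`. [cite: Serre1979, Ch. V §2 Prop. 3; Ch. I §7 Prop. 21] [cite: NeukirchANT1999, Ch. II §7] -/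
theorem exists_traceOne_valuation_le_one (hunr : Algebra.IsUnramifiedIn (𝓞 L) v.asIdeal) :
    ∃ b : L, b + IsCMField.complexConj L b = 1 ∧ w.1.valuation L b ≤ 1 := by
  haveI : Algebra.IsQuadraticExtension ↥(maximalRealSubfield L) L := IsCMField.isQuadraticExtension L
  obtain ⟨a, ha⟩ := exists_smul_sub_notMem (IsCMField.complexConj L) w (IsCMField.complexConj_ne_one L) hw hunr
  -- `t := c a − a ∉ 𝔓_w` is a `w`-adic unit
  have ht1 : w.1.valuation L (((IsCMField.complexConj L • a - a : 𝓞 L)) : L) = 1 :=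
    (HeightOneSpectrum.valuation_eq_one_iff_notMem (K := L) (v := w.1)).2 ha
  have hca : ((IsCMField.complexConj L • a : 𝓞 L) : L) = IsCMField.complexConj L (a : L) := RingOfIntegers.coe_algEquiv_smul _ _ a
  have hsub : ((IsCMField.complexConj L • a - a : 𝓞 L) : L) = IsCMField.complexConj L (a : L) - (a : L) := by
    rw [RingOfIntegers.coe_eq_algebraMap, map_sub]; rfl
  have ht0 : IsCMField.complexConj L (a : L) - (a : L) ≠ 0 := fun h => by
    rw [hsub, h, map_zero] at ht1; exact zero_ne_one ht1
  refine ⟨IsCMField.complexConj L (a : L) / (IsCMField.complexConj L (a : L) - (a : L)), ?_, ?_⟩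
  · rw [map_div₀, map_sub, IsCMField.complexConj_apply_apply, div_add_div _ _ ht0 (sub_ne_zero.2 (sub_ne_zero.1 ht0).symm), div_eq_one_iff_eq
      (mul_ne_zero ht0 (sub_ne_zero.2 (sub_ne_zero.1 ht0).symm))]
    ring
  · rw [map_div₀, ← hsub, ht1, div_one, ← hca]
    exact HeightOneSpectrum.valuation_le_one w.1 _

/-! ## §2 In the completion `L_w`: `b + σ_w b = 1`, `|b|_w ≤ 1` -/

include hw in
/-- **TRACE ONE IN `𝒪_w ⊂ L_w`** at an unramified non-split place (dyadic or not): `∃ b ∈ L_w`, `|b|_w ≤ 1`, `b + σ_w b = 1`, where `σ_w = galAdicCompletionMap c` is the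
extension of `c` to `L_w` (the image of §1's global `b`; ★ `galAdicCompletionMap_coe_algEquiv`, `valuedAdicCompletion_eq_valuation'`).  Equivalent to the surjectivity
of `tr : 𝒪_{L_w} → 𝒪_{L⁺_v}`. [cite: Serre1979, Ch. V §2 Prop. 3] [cite: NeukirchANT1999, Ch. II §7] -/
theorem exists_traceOne_adicCompletion (hunr : Algebra.IsUnramifiedIn (𝓞 L) v.asIdeal) :
    ∃ b : w.1.adicCompletion L, Valued.v b ≤ 1 ∧ b + galAdicCompletionMap (L := L) (IsCMField.complexConj L) hw b = 1 := by
  obtain ⟨b, hb, hb1⟩ := exists_traceOne_valuation_le_one L v w hw hunr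
  refine ⟨(b : w.1.adicCompletion L), ?_, ?_⟩
  · rw [HeightOneSpectrum.valuedAdicCompletion_eq_valuation']; exact hb1
  · rw [galAdicCompletionMap_coe_algEquiv]
    have h := congrArg (algebraMap L (w.1.adicCompletion L)) hb
    rw [map_add, map_one] at h
    exact h

include hw in
/-- **TRACE ONE IN THE VALUATION RING `𝒪_w`** (subtype form): `∃ b ∈ 𝒪_w` with `(b : L_w) + σ_w b = 1`. [cite: Serre1979, Ch. V §2 Prop. 3] -/
theorem exists_traceOne_adicCompletionIntegers (hunr : Algebra.IsUnramifiedIn (𝓞 L) v.asIdeal) :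
    ∃ b : w.1.adicCompletionIntegers L, (b : w.1.adicCompletion L) + galAdicCompletionMap (L := L) (IsCMField.complexConj L) hw b = 1 := by
  obtain ⟨b, hb1, hb⟩ := exists_traceOne_adicCompletion L v w hw hunr
  exact ⟨⟨b, (HeightOneSpectrum.mem_adicCompletionIntegers _ _ _).2 hb1⟩, hb⟩

/-! ## §3 In `E_v = Π_{w′ ∣ v} L_{w′}`: the binders `z₀ hz₀ hz₀1` of ★ p856585 -/

include hw in
/-- **TRACE ONE IN `E_v`, INTEGRAL AT EVERY PLACE ABOVE `v`** — the hypothesis of ★ `K2E3HeightBallIndexViaCentre.measure_heightBall_inv_eq_mul_of_traceOne` discharged at every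
inert place, dyadic included: `v` non-split and unramified in `L` ⇒ `∃ z₀ : E_v`, `z₀ + σ z₀ = 1` (`σ = c ⊗ 1 = conjLocal`) and `|z₀|_{w′} ≤ 1` for every `w′ ∣ v`
(there is exactly one, ★ `PlacesOver.subsingleton_of_smul_eq`).  `z₀ = b ⊗ 1` for §1's global `b` (★ `conjLocal_algebraMap`). [cite: Serre1979, Ch. V §2 Prop. 3]
[cite: Rogawski1990, §1.10 p. 9] -/
theorem exists_traceOne_localRing (hunr : Algebra.IsUnramifiedIn (𝓞 L) v.asIdeal) :
    ∃ z₀ : LocalRing L v, z₀ + conjLocal L (IsCMField.complexConj L) v z₀ = 1 ∧ ∀ w' : PlacesOver L v, Valued.v (z₀ w') ≤ 1 := by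
  haveI : Algebra.IsQuadraticExtension ↥(maximalRealSubfield L) L := IsCMField.isQuadraticExtension L
  haveI : Subsingleton (PlacesOver L v) := PlacesOver.subsingleton_of_smul_eq (IsCMField.complexConj L) (IsCMField.complexConj_ne_one L) w hw
  obtain ⟨b, hb, hb1⟩ := exists_traceOne_valuation_le_one L v w hw hunr
  refine ⟨algebraMap L (LocalRing L v) b, ?_, fun w' => ?_⟩
  · rw [conjLocal_algebraMap, ← map_add, hb, map_one]
  · rw [Subsingleton.elim w' w, Pi.algebraMap_apply]
    change Valued.v ((b : w.1.adicCompletion L)) ≤ 1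
    rw [HeightOneSpectrum.valuedAdicCompletion_eq_valuation']; exact hb1

include hw in
/-- The `w`-reading of §3 (the literal binders of ★ p856585 §4: `z₀`, `hz₀ : z₀ + conjLocal z₀ = 1`, `hz₀1 : Valued.v (z₀ w) ≤ 1`). [cite: Serre1979, Ch. V §2 Prop. 3] -/
theorem exists_traceOne_localRing_at (hunr : Algebra.IsUnramifiedIn (𝓞 L) v.asIdeal) :
    ∃ z₀ : LocalRing L v, z₀ + conjLocal L (IsCMField.complexConj L) v z₀ = 1 ∧ Valued.v (z₀ w) ≤ 1 := by
  obtain ⟨z₀, hz₀, hz₀1⟩ := exists_traceOne_localRing L v w hw hunr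
  exact ⟨z₀, hz₀, hz₀1 w⟩

end Summit.HodgeConjecture.HodgeConjecture.Cruxes.H413.K2E3TraceOneAtUnramifiedInertPlace

end
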